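import Summits.AnomalousDissipation.AnomalousDissipation.Theorems.KolmogorovFloorEnsembleCeiling.Negative.SameForce
import Summits.AnomalousDissipation.AnomalousDissipation.Theorems.KolmogorovFloorEnsembleCeiling.Negative.SoftPlanar
import Literature.Analysis.FunctionSpaces.TorusAxisAverageCalculus

/-!
# Negative knowledge for the crux `KolmogorovFloorEnsembleCeiling` (stmt-AnomalousDissipation-14183), IV:
# planar forces as given on `T³` (intrinsic form of the planar kill)

cdisprove seat `refuter-cdisprove-stmt-AnomalousDissipation-14183-0`, 2026-08-16. Parts II/III exclude the forces
`planarLift g = (g₁, g₂, 0)∘π` built from a planar field `g`. This file restates the exclusion for a force GIVEN on `T³`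
through the intrinsic predicate `IsPlanarForce f` — invariance under the translations along the third axis and a
vanishing third component — by identifying such an `f` with the planar lift of its planar section
(`eq_planarLift_planarSection`, from `eq_comp_planarSect_comp_planarProj` of `TorusAxisAverageCalculus`):
`not_pair_of_isPlanarForce`, `not_floor_ceiling_of_isPlanarForce` (the target's `∀ ν`-body),
`not_softFloor_ceiling_of_isPlanarForce`, `not_loudBounded_of_isPlanarForce` (#3's body). Nothing here asserts a
Theses statement.
-/

noncomputable section

set_option linter.dupNamespace false

open MeasureTheory UnitAddTorus
open scoped InnerProductSpace ENNReal

namespace Summit.AnomalousDissipation.AnomalousDissipation.Theorems.KolmogorovFloorEnsembleCeiling.Negative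

open Literature.Analysis.FunctionSpaces Literature.Analysis.FunctionSpaces.Torus Literature.Analysis.FluidPDE
open Summit.AnomalousDissipation.AnomalousDissipation.Theses.TaylorCertificates
open Summit.AnomalousDissipation.AnomalousDissipation.Theorems.FloorCertificate.Negative

local notation "𝕋³" => UnitAddTorus (Fin 3)
local notation "𝕋²" => UnitAddTorus (Fin 2)
local notation "E³" => EuclideanSpace ℝ (Fin 3)
local notation "E²" => EuclideanSpace ℝ (Fin 2)

/-- A force on `T³` is PLANAR: invariant under the translations along the third axis and with vanishing third
component (`f = (f₁, f₂, 0)(x₁, x₂)`). -/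
def IsPlanarForce (f : 𝕋³ → E³) : Prop :=
  (∀ (s : UnitAddCircle) (x : 𝕋³), f (x + Pi.single (Fin.last 2) s) = f x) ∧ ∀ x, f x 2 = 0

/-- The planar section of a force on `T³`: `g(y) = (f₁, f₂)(y₁, y₂, 0)`. -/
def planarSection (f : 𝕋³ → E³) : 𝕋² → E² := fun y => planarProjE (f (planarSect y))

/-- **A planar force is the planar lift of its planar section.** -/
theorem eq_planarLift_planarSection {f : 𝕋³ → E³} (hf : IsPlanarForce f) : f = planarLift (planarSection f) := by
  have hinv := eq_comp_planarSect_comp_planarProj hf.1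
  funext x
  have hx : f x = f (planarSect (planarProj x)) := congrFun hinv x
  -- compare components
  have h3 := hf.2 (planarSect (planarProj x))
  rw [hx]
  ext i
  refine Fin.lastCases ?_ (fun j => ?_) i
  · rw [show (Fin.last 2 : Fin 3) = 2 from rfl, h3, planarLift, twoHalf_apply_two]
    rfl
  · rw [planarLift, twoHalf_apply_castSucc, planarSection, planarProjE_apply]

/-- The planar section of a smooth force is smooth. -/
theorem isSmooth_planarSection {f : 𝕋³ → E³} (hf : IsSmooth f) : IsSmooth (planarSection f) :=
  (hf.comp_planarSect).comp_clm planarProjE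

/-- The planar section of a planar mean-zero force is mean zero. -/
theorem hasZeroMean_planarSection {f : 𝕋³ → E³} (hf : IsSmooth f) (hpl : IsPlanarForce f) (hmean : HasZeroMean f) :
    HasZeroMean (planarSection f) := by
  have hg := isSmooth_planarSection hf
  unfold HasZeroMean
  -- `∫_{T²} g = ∫_{T³} g ∘ π = ∫_{T³} πE ∘ f = πE (∫ f) = 0`
  rw [← integral_comp_planarProj (b := planarSection f) hg.continuous.aestronglyMeasurable]
  have hpt : ∀ x : 𝕋³, planarSection f (planarProj x) = planarProjE (f x) := by
    intro x
    have hx : f x = f (planarSect (planarProj x)) := congrFun (eq_comp_planarSect_comp_planarProj hpl.1) x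
    rw [planarSection, ← hx]
  simp_rw [hpt]
  rw [ContinuousLinearMap.integral_comp_comm planarProjE hf.integrable]
  have h0 : ∫ x, f x = 0 := hmean
  rw [h0, map_zero]

/-- **No planar witness of the pair, intrinsic form**: a smooth mean-zero PLANAR force carries no pair. -/
theorem not_pair_of_isPlanarForce {f : 𝕋³ → E³} (hf : IsSmooth f) (hpl : IsPlanarForce f) (hmean : HasZeroMean f) :
    ¬ ∃ (ε₀ C Θ E ν₀ : ℝ), PairFor f ε₀ C Θ E ν₀ := by
  rw [eq_planarLift_planarSection hpl]
  exact not_pair_planar (isSmooth_planarSection hf) (hasZeroMean_planarSection hf hpl hmean)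

/-- **No planar witness of the target `X`, intrinsic form** (its `∀ ν`-body: floor family AND ensemble ceiling). -/
theorem not_floor_ceiling_of_isPlanarForce {f : 𝕋³ → E³} (hf : IsSmooth f) (hpl : IsPlanarForce f)
    (hmean : HasZeroMean f) :
    ¬ ∃ (ε₀ E ν₀ : ℝ), 0 < ε₀ ∧ 0 < ν₀ ∧ ∀ ν : ℝ, 0 < ν → ν < ν₀ →
      FloorFamily f ε₀ ν ∧
      (∀ μ : Measure (Torus.energySpace (Fin 3)), Torus.IsStationaryStatisticalSolution ν f μ →
        Integrable (fun v : Torus.energySpace (Fin 3) => ‖v‖ ^ 2) μ → Torus.ensembleEnergy μ ≤ E) := by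
  rw [eq_planarLift_planarSection hpl]
  exact not_floor_ceiling_planar (isSmooth_planarSection hf) (hasZeroMean_planarSection hf hpl hmean)

/-- **No planar witness of the soft re-cut, intrinsic form.** -/
theorem not_softFloor_ceiling_of_isPlanarForce {f : 𝕋³ → E³} (hf : IsSmooth f) (hpl : IsPlanarForce f)
    (hmean : HasZeroMean f) :
    ¬ ∃ (ε₀ E ν₀ lam : ℝ), 0 < ε₀ ∧ 0 < ν₀ ∧ 0 ≤ lam ∧ lam * E < ε₀ ∧ ∀ ν : ℝ, 0 < ν → ν < ν₀ →
      SoftFloorFamily f ε₀ lam ν ∧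
      (∀ μ : Measure (Torus.energySpace (Fin 3)), Torus.IsStationaryStatisticalSolution ν f μ →
        Integrable (fun v : Torus.energySpace (Fin 3) => ‖v‖ ^ 2) μ → Torus.ensembleEnergy μ ≤ E) := by
  rw [eq_planarLift_planarSection hpl]
  exact not_softFloor_ceiling_planar (isSmooth_planarSection hf) (hasZeroMean_planarSection hf hpl hmean)

/-- **No planar witness of route item #3's body, intrinsic form**: the smooth classical steady states of a planar
force are never uniformly loud-and-bounded. -/
theorem not_loudBounded_of_isPlanarForce {f : 𝕋³ → E³} (hf : IsSmooth f) (hpl : IsPlanarForce f)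
    (hmean : HasZeroMean f) :
    ¬ ∃ (ε₀ E ν₀ : ℝ), 0 < ε₀ ∧ 0 < ν₀ ∧ ∀ ν : ℝ, 0 < ν → ν < ν₀ → LoudBoundedSteadyAt f ε₀ E ν := by
  rw [eq_planarLift_planarSection hpl]
  exact not_steadyStatesLoudBounded_planar (isSmooth_planarSection hf) (hasZeroMean_planarSection hf hpl hmean)

end Summit.AnomalousDissipation.AnomalousDissipation.Theorems.KolmogorovFloorEnsembleCeiling.Negative
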